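import Mathlib.Data.Nat.Log
import Literature.Computability.Cryptography.QuantumCircuit
import Literature.Computability.Cryptography.ClassBQP
import Literature.Computability.Complexity.Classes
import HarnessLib

/-!
# Barrier catalogue `QuantumAdvantage` — low treewidth: tensor-network contraction (Markov–Shi) and the simulations of the 2019 supremacy circuits

Topic `Literature/Barriers/QuantumAdvantage` (D-0021). Summit statement:
`QuantumAdvantage := ∃ L, L ∈ BQP ∧ L ∉ BPP`.

BARRIER: technique_class := witnessing quantum advantage — the summit's `L ∈ BQP \ BPP`, or its
  finite experimental proxies (random circuit sampling on a planar chip) — with circuits whose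
  tensor network has small treewidth: constant-range ("`q`-local-interacting") architectures of
  logarithmic depth, log-treewidth families in general, and fixed instances small enough for their
  networks to be contracted in practice [cite: MarkovShi2008, §1 (Thm 1.1, Cor 1.2, Cor 1.5)];
  blocks := (i) as a route to the summit: a uniform polynomial-size family of `q`-local-interacting
  circuits of depth `≤ c·log n` decides only languages in `P` (`markovShi2008_cor15`, the
  language-level reading of Cor 1.5), and "given a function computable in polynomial time by a
  quantum algorithm but not classically, any polynomial-size quantum circuit computing the function
  must have super-logarithmic treewidth" (remark after Thm 1.1) [cite: MarkovShi2008, Thm 1.1, Cor 1.2, Cor 1.5];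
  (ii) as experimental evidence: the 53-qubit, 20-cycle Sycamore random-circuit sampling task
  [cite: AruteEtAl2019, Suppl. Inf. §7 (quantum circuits) and §10 (classical simulations)] —
  "the noisy sampling task with fidelity `f ≈ 0.002` can be achieved experimentally using the
  quantum hardware in about 200 sec, while they estimated that it would take 10,000 yr on modern
  supercomputers", an estimate that "relies on a specific classical algorithm, the
  Schrödinger-Feynman algorithm" [cite: PanChenZhang2022, §1 (introduction)] — was subsequently
  estimated or performed classically by tensor-network contraction: `≈ 2.5` days on
  Summit using secondary storage (an estimate, "we did not carry out these computations")
  [cite: PednaultEtAl2019, §1]; "less than 20 days" on a Summit-comparable cluster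
  [cite: HuangEtAl2020, (abstract)]; `10⁶` uncorrelated samples from an approximate state of
  fidelity `≈ 0.0037` in about `15 h` on `512` GPUs [cite: PanChenZhang2022, (abstract)];
  `304 s` for the sampling task on the new Sunway machine [cite: LiuEtAl2021, (abstract)];
  because := a quantum circuit with `T` constant-width gates is a tensor network on its circuit
  graph `G_C`; contracting it along a tree decomposition of width `d` costs `T^{O(1)} exp[O(d)]`
  deterministic time and yields exact measurement probabilities (Thm 1.1, rigorous form
  Thm 4.6), and for a `q`-local-interacting circuit of depth `D` the cut parameter `r` of Prop 5.1
  is `O(qD)`, giving `T^{O(1)} exp[O(qD)]` (Cor 1.5); "the minimal cost of contraction is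
  determined by the treewidth" [cite: MarkovShi2008, §1, Thm 1.1, Thm 4.6, Prop 5.1, Cor 1.5];
  the cited simulations of the finite instance combine contraction ordering ("stem" optimisation),
  slicing and secondary storage [cite: HuangEtAl2020, (abstract)] [cite: PednaultEtAl2019, §1];
  evasions_known := super-logarithmic treewidth (deep or long-range circuits) escapes (i)
  [cite: MarkovShi2008, §1 (remark after Thm 1.1)]; on the experimental side, larger and deeper
  instances: a `67`-qubit, `32`-cycle RCS experiment whose cost is stated to be "beyond the
  capabilities of existing classical supercomputers, even when accounting for the inevitable
  presence of noise", together with an identified weak-noise phase in which XEB tracks fidelity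
  [cite: MorvanEtAl2024, (abstract)]; the complexity-theoretic reading that any finite experiment
  addresses an asymptotic claim only indirectly [cite: AaronsonChen2017, §1];
  scope_caveats := (barrier audit 2026-08-14, refuter) (a) LINEAR locality only:
  `q`-local-interacting means bandwidth `≤ q` "under a linear ordering of its qubits"
  [cite: MarkovShi2008, §1 (before Cor 1.5)]; an `L₁ × L₂` planar grid has bandwidth
  `min(L₁, L₂)`, and Markov–Shi contraction of a depth-`d` circuit on it costs
  `exp(O(min(L₁L₂, L₁d, L₂d)))` ("the simulation cost is dominated by the size of the smallest cut
  bisecting this [space-time] volume") [cite: NappEtAl2022, §1 (eq. 2D-contract)] — polynomial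
  only for strips of width `O(log n / d)`; for planar circuits of size `T` the source itself gives
  only `exp(O(√T))` (Cor 1.4) and exhibits depth-4 circuits — "including the final measurement as
  the 4th layer", i.e. three layers of gates — of treewidth `Ω(n)` (Thm 1.7; with two layers of
  gates, "depth-3", the simulation is polynomial, Thm 1.8) [cite: MarkovShi2008, §1 (Cor 1.4, Thm 1.7, Thm 1.8)];
  so block (i) does not touch constant-range circuits on a 2D chip (the "planar chip" of the
  technique class) from three layers of gates on, where instead (DEPTH CONVENTIONS: Markov–Shi and
  Terhal–DiVincenzo count the final measurement round as a layer, Napp et al. count gate layers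
  only; the threshold is the same — three layers of gates): output probabilities are `#P`-hard
  for certain depth-3 architectures [cite: NappEtAl2022, §1], "if there is an efficient density
  computation of all quantum circuits `QC(|0⟩, d = 4)`, then `PH ⊆ BPP` and `BQP ⊆ BPP`" while
  depth `d = 3` admits one [cite: TerhalDiVincenzo2004, Cor 2 and Prop 2], and
  constant-depth nearest-neighbour circuits on a 2D grid solve 2D-HLF, which bounded-fan-in
  constant-depth classical circuits cannot [cite: BravyiGossetKonig2018, (abstract)]; as SAMPLING
  proxies, constant-time ("quench") evolutions under a nearest-neighbour translation-invariant
  Hamiltonian on a square lattice — "NNTI two-local constant-depth IQP circuits" — cannot be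
  sampled classically "up to error 1/22 in `ℓ₁` norm" in polynomial time unless the polynomial
  hierarchy collapses to its third level, conditional on an average-case hardness and an
  anti-concentration conjecture [cite: BermejoVegaEtAl2018, §1 (Thm 1)];
  (b) for the summit's single-output-wire DECISION form the content of Cor 1.5 is a light cone,
  not treewidth: wire `0` of a depth-`D` circuit that is `q`-local under an ordering depends only
  on the `≤ 2qD + 1` wires within distance `qD` of it and on the gates inside that cone, so for
  `D = O(log n)` the acceptance probability is a brute-force state-vector computation on
  `O(log n)` qubits and the decided language depends on `O(log n)` input positions per length
  (elementary observation of this audit, not a cited result); the tensor-network content proper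
  is the cut-parameter form Prop 5.1 (`r = O(log n)`, ARBITRARY depth, e.g. polynomial-depth
  "ladder" circuits) [cite: MarkovShi2008, §5 (Prop 5.1)] [cite: Jozsa2006, §1 (Thm 1) and §3 (Remarks)],
  typed below as `markovShi2008_prop51` (with the qubit indexing SUPPLIED, as printed —
  "whose qubits are indexed by `[n]`" — restated so 2026-08-15, see its docstring); treewidth
  itself (Thm 1.1 / Cor 1.2: logarithmic treewidth with long-range gates, e.g. trees of CNOTs)
  is typed in the companion file
  `TensorNetworkContractionTreewidth.lean` over `Literature.Combinatorics.SimpleGraph.treewidth`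
  of the circuit graph `circuitGraph` (`TensorNetworkContractionGraph.lean`): the named fact
  `markovShi2008_thm46` is the contraction theorem with the tree decomposition SUPPLIED (Thm 4.6,
  Steps 1, 3, 4 of its proof: Props 3.5, 3.6, 4.2, Lemma 4.4), and the treewidth form as printed
  (no decomposition supplied) is the conclusion of the theorem `markovShi2008_cor12_of_thm46`
  relative to the explicit Robertson–Seymour hypothesis (Thm 4.3 = Step 2, which the paper
  cites from [RSX] and the library does not have); with the theorems `treewidth_circuitGraph_le`
  (`tw(G_C) ≤ 2r + 1`, the content of the printed proof of Prop 5.1) and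
  `markovShi2008_prop51_anyOrder_of_thm46` (same two inputs; its conclusion is Prop 5.1 in the
  ORDERING-FREE form — some ordering per `n`, none supplied — which needs Thm 4.3 and implies
  the typed `markovShi2008_prop51`, `markovShi2008_prop51_of_anyOrder`) [cite: MarkovShi2008, §1 (Thm 1.1, Cor 1.2) and §4 (Thm 4.3, Thm 4.6)];
  (c) the typed `markovShi2008_cor15` fixes the wire order of `Fin (n + ancillas n)`
  (inputs first, ancillas last) where the source quantifies over linear orderings: under the
  fixed order no ancilla is within range `q` of input wire `0` once `n > q`, so the typed class is
  degenerate and an interleaved data/ancilla chain "evades" it only nominally; the faithful form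
  is `markovShi2008_cor15_anyOrder` (the ordering may depend on `n`), and
  ordering-free Prop 5.1 `→ markovShi2008_cor15_anyOrder → markovShi2008_cor15` as well as
  `markovShi2008_prop51 →` Cor 1.5 with the ordering supplied are theorems below
  (`markovShi2008_cor15_anyOrder_of_prop51_anyOrder`, `markovShi2008_cor15_of_anyOrder`,
  `markovShi2008_cor15_supplied_of_prop51`; `r ≤ q · depth`, `QCircuit.cutParamUnder_le`);
  (d) model: unitary gate lists with one final
  measurement; adaptive circuits (mid-circuit measurements with feed-forward) enter Markov–Shi
  only through Thm 1.6 (one-way computation on a graph state of treewidth `t`, randomized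
  `exp(O(t))` time) [cite: MarkovShi2008, §1 (Thm 1.6)], and logarithmic-depth circuits WITH
  long-range two-qubit gates plus polynomial-time classical processing are "known to be capable
  of solving hard problems such as factoring" [cite: BravyiGossetKonig2018, §1 (citing Cleve–Watrous 2000)]
  — depth alone is no barrier, the range is [cite: Jozsa2006, §3 (p. 6: constant versus O(log n) range)];
  (e) block (ii) is a small-`n` record, not a treewidth statement: at `20 > √53` cycles the
  Sycamore network is in the full-width regime of (a) (cost `exp(Θ(n))` at `n = 53`, feasible
  with slicing, secondary storage and a target fidelity `f ≪ 1`); as printed, Huang et al.'s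
  "less than 20 days" is an ESTIMATE from explicitly simulated subtasks
  [cite: HuangEtAl2020, (abstract)], Liu et al.'s `304 s` produced one batch of `2²¹` correlated
  amplitudes with 32 qubits frozen ("a scaling multiplies 304 seconds into 7 days" for the
  uncorrelated equivalent) [cite: LiuEtAl2021, Appendix A], and later `3 × 10⁶` uncorrelated
  samples with XEB `2 × 10⁻³` were produced in `86.4 s` on `1432` GPUs using top-`k` XEB
  amplification [cite: ZhaoEtAl2024, §2 (summary of results)];
  status := theorem for (i) (Markov–Shi); (ii) is a record of published computations and
  estimates as printed (Pednault et al. is an estimate, not a run).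

## Contents

* `QCircuit.IsLocalInteracting q C` — Markov–Shi's `q`-local-interacting circuits (each gate acts
  on wires at mutual distance `≤ q` in the linear order of the wires), a deliberate dot-notation
  extension of Q2's `Literature.Computability.Cryptography.QCircuit`; API `isLocalInteracting_nil`,
  `IsLocalInteracting.mono`.
* `markovShi2008_cor15` — Corollary 1.5 read at the language level for uniform Clifford+T
  families (the form comparable with the summit).
* (audit 2026-08-14) `QCircuit.IsLocalInteractingUnder σ q C` — locality under an arbitrary linear
  ordering `σ` of the wires (the source's definition); `QCircuit.cutLoadUnder σ C i`,
  `QCircuit.cutParamUnder σ C` — Markov–Shi's cut parameter `r` of Prop 5.1 (number of gates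
  acting on wires on both sides of the cut after position `i`); the combinatorial theorems
  `QCircuit.countP_mem_wires_le_depth` (a wire carries at most `depth` gates) and
  `QCircuit.cutParamUnder_le` (`r ≤ q · depth` for `q`-local circuits, the step "`r = O(qD)`" of
  the source); `markovShi2008_cor15_anyOrder` (Cor 1.5, faithful ordering), `markovShi2008_prop51`
  (Prop 5.1 at the language level, the qubit indexing supplied by an `FP` function of `1ⁿ` —
  restated so 2026-08-15 at the review of its decomposition, D-0026; the audit's ordering-free
  form `∀ n, ∃ σ` needs Robertson–Seymour to be decided and survives as a hypothesis /
  conclusion of theorems) and the reductions `markovShi2008_cor15_of_anyOrder`,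
  `markovShi2008_cor15_anyOrder_of_prop51_anyOrder` (from the ordering-free Prop 5.1),
  `markovShi2008_prop51_of_anyOrder` (ordering-free ⟹ supplied) and
  `markovShi2008_cor15_supplied_of_prop51` (Cor 1.5 with the ordering supplied, from the typed
  Prop 5.1: `r ≤ q·D`).
* (2026-08-15, companion files) `TensorNetworkContractionGraph.lean`: the circuit graph `G_C`
  (`circuitGraph`) and the bags of Prop 5.1; `TensorNetworkContractionTreewidth.lean`:
  `treewidth_circuitGraph_le`, the named fact `markovShi2008_thm46` (Thm 4.6 with the tree
  decomposition of its Step 2 supplied in the rooted normal form `RootedTreeDecomposition` —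
  the contraction theorem proper; restated so 2026-08-15 at the review of the decomposition of
  `markovShi2008_prop51`), `markovShi2008_cor12_of_thm46` (the treewidth form Thm 1.1 / Cor 1.2,
  relative to Robertson–Seymour's Thm 4.3 as an explicit hypothesis) and
  `markovShi2008_prop51_anyOrder_of_thm46` (likewise, concluding the ordering-free Prop 5.1),
  so that the chain `markovShi2008_thm46 →` ordering-free Prop 5.1
  `→ markovShi2008_cor15_anyOrder → markovShi2008_cor15` consists of theorems, the first arrow
  relative to Thm 4.3, while the arrow `markovShi2008_thm46 → markovShi2008_prop51` (indexing
  supplied: the printed path decomposition as an `FP` function, no Thm 4.3) is the remaining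
  obligation of the typed Prop 5.1 and is not yet in the tree; treewidth lives in
  `Literature/Combinatorics/SimpleGraph/TreeDecomposition.lean` (and `LineGraphTreewidth.lean`
  for Lemma 4.4).


## Design notes

* Rendering of Cor 1.5. The source states: a size-`T`, depth-`D`, `q`-local-interacting circuit
  "can be simulated deterministically in `T^{O(1)} exp[O(qD)]` time", where a deterministic
  simulation outputs the exact probability of a given measurement outcome (§1). For a poly-time
  uniform (hence polynomial-size) oracle-free family with `D ≤ c log₂ n + c` and fixed `q` this is
  polynomial in `n`, so the language the family decides with gap `(2/3, 1/3)` is in `P` (compute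
  the acceptance probability, compare with `1/2`; for Clifford+T the amplitudes lie in
  `ℤ[i, 1/√2]` and the computation is exact). We vendor this reading; treewidth itself (Thm 1.1,
  Cor 1.2) was not defined in the tree at the time and is quoted in prose in this file; it is
  now typed in `TensorNetworkContractionTreewidth.lean` (`markovShi2008_thm46` with the
  decomposition supplied, `markovShi2008_cor12_of_thm46` for the printed treewidth form relative
  to Robertson–Seymour).
* `Nat.log 2 n` renders `log n`; polynomial size is required explicitly (`IsPolySize`) besides
  uniformity, so the statement does not lean on the fact `IsUniform.isPolySize`.
* Mathlib/tree search (at the audit): no `treewidth`, `TreeDecomposition`, `localInteracting`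
  (`lean search`) — treewidth has since been added, see `## Contents`;
  `QCircuit.depth`, `QGate.wires`, `QCircuitFamily.IsUniform/IsPolySize/acceptProbOn` are Q2's.
* (audit) Prop 5.1 is stated in the source for qubits "indexed by `[n]`" with `r` the least
  integer such that for every `i` at most `r` gates act on some qubits `j ≤ i < j'`; we count gate
  occurrences in the list (`List.countP`) under the positions `σ`, take the maximum over cut
  positions, and read the conclusion `T^{O(1)} exp[O(r)]` at the language level exactly as for
  Cor 1.5; the indexing `σ_n` is handed to the decider by an `FP` function of `1ⁿ` (list of
  positions under `encodingListNatBool`, cf. the `FP`-supplied decomposition of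
  `markovShi2008_thm46`), the uniform-family reading of "whose qubits are indexed by `[n]`"
  (review 2026-08-15; the audit's `∀ n, ∃ σ` hid the ordering from the decider, which then
  needs Thm 4.3 to find a decomposition). The printed proof of Prop 5.1 takes the bags `B_i` =
  gates crossing cut `i`; property
  (T2) needs the slightly larger bags "gates touching or crossing line `i`" (Jozsa's
  `D_i ≤ r_{i-1} + r_i`), which changes the width by a factor `≤ 2` and not the statement
  [cite: Jozsa2006, §1 (Thm 1)].


## References

* [MarkovShi2008] I. L. Markov, Y. Shi, *Simulating quantum computation by contracting tensor
  networks*, SIAM J. Comput. 38 (2008) 963–981 (arXiv:quant-ph/0511069): §1, Thm 1.1, Cor 1.2,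
  Cor 1.5, Thm 4.6, Prop 5.1. Read via `lit read paper:arxiv-quant-ph_0511069`.
* [AruteEtAl2019] F. Arute et al., *Quantum supremacy using a programmable superconducting
  processor*, Nature 574 (2019) 505–510; Supplementary Information arXiv:1910.11333, §4 (XEB
  theory), §7, §10. Read via `lit read paper:arxiv-1910.11333`.
* [PednaultEtAl2019] E. Pednault, J. Gunnels, G. Nannicini, L. Horesh, R. Wisnieff, *Leveraging
  secondary storage to simulate deep 54-qubit Sycamore circuits*, arXiv:1910.09534, §1.
* [HuangEtAl2020] C. Huang et al., *Classical simulation of quantum supremacy circuits*,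
  arXiv:2005.06787, abstract.
* [PanChenZhang2022] F. Pan, K. Chen, P. Zhang, *Solving the sampling problem of the Sycamore
  quantum circuits*, Phys. Rev. Lett. 129 (2022) 090502 (arXiv:2111.03011), abstract.
* [LiuEtAl2021] Y. Liu et al., *Closing the "quantum supremacy" gap: achieving real-time
  simulation of a random quantum circuit using a new Sunway supercomputer*, SC '21
  (arXiv:2110.14502), abstract.
* [MorvanEtAl2024] A. Morvan et al., *Phase transitions in random circuit sampling*, Nature 634
  (2024) 328–333 (arXiv:2304.11119), abstract.
* [AaronsonChen2017] S. Aaronson, L. Chen, CCC 2017 (arXiv:1612.05903), §1.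
* [Jozsa2006] R. Jozsa, *On the simulation of quantum circuits*, arXiv:quant-ph/0603163, §1
  (Def. 1, Thm 1), §3 (remarks). Read via `lit read arxiv:quant-ph/0603163`.
* [NappEtAl2022] J. C. Napp, R. L. La Placa, A. M. Dalzell, F. G. S. L. Brandão, A. W. Harrow,
  *Efficient classical simulation of random shallow 2D quantum circuits*, Phys. Rev. X 12 (2022)
  021021 (arXiv:2001.00021), §1. Read via `lit read paper:arxiv-2001.00021`.
* [TerhalDiVincenzo2004] B. M. Terhal, D. P. DiVincenzo, *Adaptive quantum computation, constant
  depth quantum circuits and Arthur–Merlin games*, Quantum Inf. Comput. 4 (2004) 134–145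
  (arXiv:quant-ph/0205133), Prop 2, Cor 2. Read via `lit read arxiv:quant-ph/0205133`.
* [BravyiGossetKonig2018] S. Bravyi, D. Gosset, R. König, *Quantum advantage with shallow
  circuits*, Science 362 (2018) 308–311 (arXiv:1704.00690), abstract and §1.
  Read via `lit read arxiv:1704.00690`.
* [BermejoVegaEtAl2018] J. Bermejo-Vega, D. Hangleiter, M. Schwarz, R. Raussendorf, J. Eisert,
  *Architectures for quantum simulation showing a quantum speedup*, Phys. Rev. X 8 (2018) 021010
  (arXiv:1703.00466), abstract and §1 (Thm 1). Read via `lit read arxiv:1703.00466`.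
* [ZhaoEtAl2024] X.-H. Zhao et al., *Leapfrogging Sycamore: harnessing 1432 GPUs for 7× faster
  quantum random circuit sampling*, Natl. Sci. Rev. 12 (2024) nwae317 (arXiv:2406.18889), §2.
  Read via `lit read paper:arxiv-2406.18889`.
-/

noncomputable section

open Computability Literature.Computability.Complexity Literature.Computability.Complexity.Classes

namespace Literature.Barriers.QuantumAdvantage

variable {G : Literature.Computability.Cryptography.QGateSet} {n : ℕ}

/-- **`q`-local-interacting circuits** (Markov–Shi, §1): "a circuit is said to be
`q`-local-interacting if under a linear ordering of its qubits, each gate acts only on qubits that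
are at most `q` distance apart"; the linear order is that of the wires `Fin n`. Deliberate
dot-notation extension of `Literature.Computability.Cryptography.QCircuit`. [cite: MarkovShi2008, §1 (before Cor 1.5)] -/
def _root_.Literature.Computability.Cryptography.QCircuit.IsLocalInteracting (q : ℕ) (C : Literature.Computability.Cryptography.QCircuit G n) : Prop :=
  ∀ g ∈ C.gates, ∀ i ∈ g.wires, ∀ j ∈ g.wires, (i : ℕ) ≤ (j : ℕ) + q

/-- The empty circuit is `q`-local-interacting for every `q`. [cite: MarkovShi2008, §1] -/
theorem _root_.Literature.Computability.Cryptography.QCircuit.isLocalInteracting_nil (q : ℕ) : (⟨[]⟩ : Literature.Computability.Cryptography.QCircuit G n).IsLocalInteracting q :=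
  fun g hg => by simp at hg

/-- Locality is monotone in the range `q`. [cite: MarkovShi2008, §1] -/
theorem _root_.Literature.Computability.Cryptography.QCircuit.IsLocalInteracting.mono {q q' : ℕ} {C : Literature.Computability.Cryptography.QCircuit G n}
    (h : C.IsLocalInteracting q) (hq : q ≤ q') : C.IsLocalInteracting q' :=
  fun g hg i hi j hj => (h g hg i hi j hj).trans (by omega)

end Literature.Barriers.QuantumAdvantage

namespace Literature.Barriers.QuantumAdvantage

open Literature.Computability.Cryptography

/-- **Markov–Shi 2008, Corollary 1.5** (language-level reading; see the module docstring):
"Let `C` be a quantum circuit of size `T` and depth `D`, and `q`-local-interacting. Then `C` can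
be simulated deterministically in `T^{O(1)} exp[O(qD)]` time. In particular, if `C` is a
polynomial-size local-interacting circuit with a logarithmic depth, then it can be simulated
deterministically in polynomial time." Hence: a language decided with error `≤ 1/3` by a
poly-time uniform, polynomial-size, oracle-free family of Clifford+T circuits which are
`q`-local-interacting and of depth `≤ c·log₂ n + c` is in `P`. [cite: MarkovShi2008, Cor 1.5] -/
def markovShi2008_cor15 : Prop :=
  ∀ (q c : ℕ) (F : QCircuitFamily cliffordT) (L : Language Bool),
    F.IsOracleFree → F.IsUniform → F.IsPolySize →
    (∀ n, (F.circ n).IsLocalInteracting q) →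
    (∀ n, (F.circ n).depth ≤ c * Nat.log 2 n + c) →
    (∀ x, (x ∈ L → 2 / 3 ≤ F.acceptProbOn 0 x) ∧ (x ∉ L → F.acceptProbOn 0 x ≤ 1 / 3)) →
    L ∈ P

end Literature.Barriers.QuantumAdvantage

/-! ### Barrier audit 2026-08-14: the source's ordering-free locality, the cut parameter of Prop 5.1, and the reductions -/

namespace Literature.Barriers.QuantumAdvantage

variable {G : Literature.Computability.Cryptography.QGateSet} {n : ℕ}

/-- **`q`-local-interacting under a linear ordering `σ`** (Markov–Shi, §1: "under a linear
ordering of its qubits, each gate acts only on qubits that are at most `q` distance apart"):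
`σ w` is the position of wire `w`; `QCircuit.IsLocalInteracting` is the case `σ = 1`
(`isLocalInteractingUnder_refl`). Deliberate dot-notation extension of Q2's
`Literature.Computability.Cryptography.QCircuit`. [cite: MarkovShi2008, §1 (before Cor 1.5)] -/
def _root_.Literature.Computability.Cryptography.QCircuit.IsLocalInteractingUnder (σ : Fin n ≃ Fin n) (q : ℕ) (C : Literature.Computability.Cryptography.QCircuit G n) : Prop :=
  ∀ g ∈ C.gates, ∀ i ∈ g.wires, ∀ j ∈ g.wires, ((σ i : Fin n) : ℕ) ≤ ((σ j : Fin n) : ℕ) + q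

/-- Locality under the identity ordering is `QCircuit.IsLocalInteracting` (definitional).
[cite: MarkovShi2008, §1 (before Cor 1.5)] -/
theorem _root_.Literature.Computability.Cryptography.QCircuit.isLocalInteractingUnder_refl {q : ℕ} {C : Literature.Computability.Cryptography.QCircuit G n} :
    C.IsLocalInteractingUnder (Equiv.refl _) q ↔ C.IsLocalInteracting q :=
  Iff.rfl

/-- Locality under an ordering is monotone in the range `q`. [cite: MarkovShi2008, §1] -/
theorem _root_.Literature.Computability.Cryptography.QCircuit.IsLocalInteractingUnder.mono {σ : Fin n ≃ Fin n} {q q' : ℕ} {C : Literature.Computability.Cryptography.QCircuit G n}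
    (h : C.IsLocalInteractingUnder σ q) (hq : q ≤ q') : C.IsLocalInteractingUnder σ q' :=
  fun g hg i hi j hj => (h g hg i hi j hj).trans (by omega)

/-- **The load of the cut after position `i`** under the ordering `σ` (Markov–Shi, Prop 5.1):
the number of gates of `C` (occurrences in the gate list) that act on some wire at position
`≤ i` and on some wire at position `> i`. Single-wire gates never cross a cut.
[cite: MarkovShi2008, §5 (Prop 5.1)] -/
def _root_.Literature.Computability.Cryptography.QCircuit.cutLoadUnder (σ : Fin n ≃ Fin n) (C : Literature.Computability.Cryptography.QCircuit G n) (i : ℕ) : ℕ :=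
  C.gates.countP fun g =>
    (∃ j ∈ g.wires, ((σ j : Fin n) : ℕ) ≤ i) ∧ (∃ j' ∈ g.wires, i < ((σ j' : Fin n) : ℕ))

/-- **Markov–Shi's cut parameter `r`** of a circuit under the ordering `σ` (Prop 5.1: "the
minimum integer so that for any `i`, no more than `r` gates act on some qubits `j` and `j'` with
`j ≤ i < j'`"): the maximum cut load over all cut positions (`0` on the empty register).
Jozsa's parameter `D = maxᵢ Dᵢ` (2-qubit gates touching or crossing line `i`) satisfies
`r ≤ D ≤ 2r` for circuits of 1- and 2-qubit gates. [cite: MarkovShi2008, §5 (Prop 5.1)]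
[cite: Jozsa2006, §1 (Thm 1)] -/
def _root_.Literature.Computability.Cryptography.QCircuit.cutParamUnder (σ : Fin n ≃ Fin n) (C : Literature.Computability.Cryptography.QCircuit G n) : ℕ :=
  Finset.univ.sup fun i : Fin n => C.cutLoadUnder σ i

/-- ASAP layering dominates gate counts per wire: starting from layers `d`, after placing the
gates `gs` the layer of wire `w` is at least `d w` plus the number of gates of `gs` acting on `w`
(each such gate is placed strictly above the current layer of `w`). [folklore] -/
theorem _root_.Literature.Computability.Cryptography.QCircuit.countP_mem_wires_le_depthAux (w : Fin n) :
    ∀ (gs : List (Literature.Computability.Cryptography.QGate G n)) (d : Fin n → ℕ),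
      d w + gs.countP (fun g => w ∈ g.wires) ≤ Literature.Computability.Cryptography.QCircuit.depthAux gs d w := by
  intro gs
  induction gs with
  | nil => intro d; simp [Literature.Computability.Cryptography.QCircuit.depthAux]
  | cons g gs ih =>
    intro d
    simp only [Literature.Computability.Cryptography.QCircuit.depthAux, List.countP_cons]
    refine le_trans ?_ (ih _)
    by_cases hw : w ∈ g.wires
    · simp only [hw, if_true, decide_true]
      have : d w ≤ g.wires.sup d := Finset.le_sup hw
      omega
    · simp [hw]

/-- **A wire carries at most `depth` gates**: the number of gates of `C` acting on the wire `w`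
is at most the (ASAP) depth of `C`. [folklore] -/
theorem _root_.Literature.Computability.Cryptography.QCircuit.countP_mem_wires_le_depth (C : Literature.Computability.Cryptography.QCircuit G n) (w : Fin n) :
    C.gates.countP (fun g => w ∈ g.wires) ≤ C.depth := by
  have h := Literature.Computability.Cryptography.QCircuit.countP_mem_wires_le_depthAux w C.gates (fun _ => 0)
  simp only [zero_add] at h
  exact h.trans (Finset.le_sup (f := Literature.Computability.Cryptography.QCircuit.depthAux C.gates fun _ => 0) (Finset.mem_univ w))

/-- Counting under a cover: if every element of `l` satisfying `P` satisfies `Q w` for some `w`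
in the finite set `W`, then `#{P} ≤ ∑_{w ∈ W} #{Q w}` along the list. [folklore] -/
theorem countP_le_sum_countP_of_cover {α β : Type*} (l : List α) (P : α → Bool) (W : Finset β)
    (Q : β → α → Bool) (h : ∀ a ∈ l, P a = true → ∃ w ∈ W, Q w a = true) :
    l.countP P ≤ ∑ w ∈ W, l.countP (Q w) := by
  induction l with
  | nil => simp
  | cons a l ih =>
    have ih' := ih (fun b hb => h b (List.mem_cons_of_mem a hb))
    simp only [List.countP_cons, Finset.sum_add_distrib]
    by_cases hP : P a = true
    · obtain ⟨w₀, hw₀, hQ⟩ := h a List.mem_cons_self hP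
      have h1 : (1 : ℕ) ≤ ∑ w ∈ W, (if Q w a = true then 1 else 0) := by
        have := Finset.single_le_sum (f := fun w => if Q w a = true then 1 else 0)
          (fun w _ => Nat.zero_le _) hw₀
        simpa [hQ] using this
      simp only [hP, if_true]
      omega
    · simp only [hP, if_false, Bool.false_eq_true]
      have : 0 ≤ ∑ w ∈ W, (if Q w a = true then 1 else 0) := Nat.zero_le _
      omega

/-- The window of a cut: at most `q` wires have their `σ`-position in `(i - q, i]`. [folklore] -/
theorem card_window_le (σ : Fin n ≃ Fin n) (q i : ℕ) :
    (Finset.univ.filter fun w : Fin n =>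
        ((σ w : Fin n) : ℕ) ≤ i ∧ i < ((σ w : Fin n) : ℕ) + q).card ≤ q := by
  classical
  calc (Finset.univ.filter fun w : Fin n =>
          ((σ w : Fin n) : ℕ) ≤ i ∧ i < ((σ w : Fin n) : ℕ) + q).card
      ≤ (Finset.Ico (i + 1 - q) (i + 1)).card := by
        refine Finset.card_le_card_of_injOn (fun w => ((σ w : Fin n) : ℕ)) ?_ ?_
        · intro w hw
          simp only [Finset.coe_filter, Finset.mem_univ, true_and, Set.mem_setOf_eq] at hw
          simp only [Finset.coe_Ico, Set.mem_Ico]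
          omega
        · intro w _ w' _ hww'
          exact σ.injective (Fin.ext hww')
    _ = (i + 1) - (i + 1 - q) := Nat.card_Ico _ _
    _ ≤ q := by omega

/-- **`r = O(qD)`, sharp form `r ≤ q · D`** (the step deriving Cor 1.5 from Prop 5.1 in the
source: "Corollary 1.5 follows since `r = O(qD)` under its assumption"): in a `q`-local circuit
under `σ`, a gate crossing the cut after position `i` acts on a wire of the window `(i - q, i]`
(its wire at position `≤ i` is within `q` of its wire at position `> i`), the window has `≤ q`
wires, and each wire carries at most `depth` gates. [cite: MarkovShi2008, §5 (after Prop 5.1)] -/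
theorem _root_.Literature.Computability.Cryptography.QCircuit.cutLoadUnder_le {σ : Fin n ≃ Fin n} {q : ℕ} {C : Literature.Computability.Cryptography.QCircuit G n}
    (hC : C.IsLocalInteractingUnder σ q) (i : ℕ) : C.cutLoadUnder σ i ≤ q * C.depth := by
  classical
  set W := Finset.univ.filter fun w : Fin n =>
      ((σ w : Fin n) : ℕ) ≤ i ∧ i < ((σ w : Fin n) : ℕ) + q with hW
  unfold Literature.Computability.Cryptography.QCircuit.cutLoadUnder
  calc C.gates.countP (fun g => decide ((∃ j ∈ g.wires, ((σ j : Fin n) : ℕ) ≤ i) ∧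
          (∃ j' ∈ g.wires, i < ((σ j' : Fin n) : ℕ))))
      ≤ ∑ w ∈ W, C.gates.countP (fun g => decide (w ∈ g.wires)) := by
        refine countP_le_sum_countP_of_cover _ _ W _ fun g hg hP => ?_
        obtain ⟨⟨j, hj, hji⟩, ⟨j', hj', hij'⟩⟩ := of_decide_eq_true hP
        have hloc := hC g hg j' hj' j hj
        refine ⟨j, ?_, decide_eq_true hj⟩
        simp only [hW, Finset.mem_filter, Finset.mem_univ, true_and]
        omega
    _ ≤ ∑ w ∈ W, C.depth := Finset.sum_le_sum fun w _ => C.countP_mem_wires_le_depth w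
    _ = W.card * C.depth := by simp
    _ ≤ q * C.depth := Nat.mul_le_mul_right _ (card_window_le σ q i)

/-- **The cut parameter of a `q`-local-interacting circuit of depth `D` is at most `q · D`**
(Markov–Shi, §5: "`r = O(qD)`"). [cite: MarkovShi2008, §5 (after Prop 5.1)] -/
theorem _root_.Literature.Computability.Cryptography.QCircuit.cutParamUnder_le {σ : Fin n ≃ Fin n} {q : ℕ} {C : Literature.Computability.Cryptography.QCircuit G n}
    (hC : C.IsLocalInteractingUnder σ q) : C.cutParamUnder σ ≤ q * C.depth :=
  Finset.sup_le fun i _ => Literature.Computability.Cryptography.QCircuit.cutLoadUnder_le hC i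

end Literature.Barriers.QuantumAdvantage

namespace Literature.Barriers.QuantumAdvantage

open Literature.Computability.Cryptography

/-- **Markov–Shi 2008, Corollary 1.5, with the source's ordering-free locality** (language
level, see the module docstring and `scope_caveats` (c)): a language decided with error `≤ 1/3`
by a poly-time uniform, polynomial-size, oracle-free family of Clifford+T circuits, each of
which is `q`-local-interacting under SOME linear ordering of its wires (the ordering may depend
on `n`) and has depth `≤ c·log₂ n + c`, is in `P`. The classical algorithm does not need the
ordering: it takes a near-optimal tree decomposition itself (Thm 4.6, Robertson–Seymour), or,
for the decision form, brute-forces the light cone of wire `0`.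
[cite: MarkovShi2008, §1 (Cor 1.5) and §4 (Thm 4.6)] -/
def markovShi2008_cor15_anyOrder : Prop :=
  ∀ (q c : ℕ) (F : QCircuitFamily cliffordT) (L : Language Bool),
    F.IsOracleFree → F.IsUniform → F.IsPolySize →
    (∀ n, ∃ σ : Fin (n + F.ancillas n) ≃ Fin (n + F.ancillas n),
      (F.circ n).IsLocalInteractingUnder σ q) →
    (∀ n, (F.circ n).depth ≤ c * Nat.log 2 n + c) →
    (∀ x, (x ∈ L → 2 / 3 ≤ F.acceptProbOn 0 x) ∧ (x ∉ L → F.acceptProbOn 0 x ≤ 1 / 3)) →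
    L ∈ P

/-- **Markov–Shi 2008, Proposition 5.1** (language-level reading, the sharper statement behind
Cor 1.5; `scope_caveats` (b)), **with the qubit indexing supplied**: "Let `C` be a quantum
circuit in which each gate has an equal number of input and output qubits, and whose qubits are
indexed by `[n]` … Suppose that the size of `C` is `T`, and `r` is the minimum integer so that
for any `i`, `1 ≤ i ≤ n-1`, no more than `r` gates act on some qubits `j` and `j'` with
`j ≤ i < j'`. Then `C` can be simulated deterministically in time `T^{O(1)} exp[O(r)]`." Hence:
a language decided with error `≤ 1/3` by a poly-time uniform, polynomial-size, oracle-free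
Clifford+T family `C_n` whose cut parameter is `≤ c·log₂ n + c` under an indexing `σ_n` of the
wires that a polynomial-time function `1ⁿ ↦ σ_n` supplies (as the list of positions
`[σ_n 0, …, σ_n (N-1)]`, `N = n + ancillas n`, under `encodingListNatBool`) is in `P` — no depth
hypothesis (polynomial-depth "ladder" circuits qualify, Jozsa §3). The indexing is part of the
data, as in the source (the qubits ARE indexed by `[n]` and `r` is defined from the indices; for
a uniform family the indexing comes with the description; the wires' own numbering
`Fin (n + ancillas n)`, inputs first and ancillas last, is the case `σ_n = 1`, and letting the
supplier choose `σ_n` keeps interleaved data/ancilla layouts in the class, cf.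
`scope_caveats` (c)): given it, the path decomposition
`B_1 — ⋯ — B_{n-1}` of the printed proof is explicit (here the bags `bagAt` and
`treewidth_circuitGraph_le` of the companion files) and the simulation is the contraction
theorem along it (Thm 4.6, Steps 1, 3, 4 = the named fact `markovShi2008_thm46` of
`TensorNetworkContractionTreewidth.lean`), with no call to Robertson–Seymour (Thm 4.3); that
effective path decomposition — an `FP` function `1ⁿ ↦ 𝒯_n` — is all that separates this fact
from `markovShi2008_thm46`, and it is not yet in the tree. (Restated 2026-08-15 at the review of
its decomposition, D-0026: the audit's version of 2026-08-14 quantified `∀ n, ∃ σ` with no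
ordering supplied; to decide such a family in `P` the machine must FIND a near-optimal
decomposition, i.e. run Thm 1.1 with its Step 2 = Thm 4.3 [RSX], a theory the paper only cites
and the library lacks. That ordering-free form implies the present one
(`markovShi2008_prop51_of_anyOrder`) and survives as the hypothesis of
`markovShi2008_cor15_anyOrder_of_prop51_anyOrder` below and as the conclusion of
`markovShi2008_prop51_anyOrder_of_thm46`, relative to Thm 4.3, in
`TensorNetworkContractionTreewidth.lean`.) Jozsa's Theorem 1 (`n·poly(2^D)` time with
`r ≤ D ≤ 2r`, the qubit lines given) is the same barrier with an elementary proof.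
[cite: MarkovShi2008, §5 (Prop 5.1)] [cite: Jozsa2006, §1 (Thm 1)] -/
def markovShi2008_prop51 : Prop :=
  ∀ (c : ℕ) (F : QCircuitFamily cliffordT) (L : Language Bool),
    F.IsOracleFree → F.IsUniform → F.IsPolySize →
    (∃ s : List Bool → List Bool, s ∈ FP ∧ ∀ n,
      ∃ σ : Fin (n + F.ancillas n) ≃ Fin (n + F.ancillas n),
        (F.circ n).cutParamUnder σ ≤ c * Nat.log 2 n + c ∧
        s (unaryEncodeNat n) =
          encodingListNatBool.encode (List.ofFn fun w => ((σ w : Fin (n + F.ancillas n)) : ℕ))) →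
    (∀ x, (x ∈ L → 2 / 3 ≤ F.acceptProbOn 0 x) ∧ (x ∉ L → F.acceptProbOn 0 x ≤ 1 / 3)) →
    L ∈ P

/-- **The ordering-free form of Prop 5.1 implies the typed one.** If bounded-error uniform
polynomial-size oracle-free Clifford+T families with cut parameter `≤ c·log₂ n + c` under SOME
ordering of the wires (per `n`, not supplied) decide only languages in `P` — Prop 5.1 read
through Thm 1.1 with its Robertson–Seymour step, the conclusion of
`markovShi2008_prop51_anyOrder_of_thm46` — then so do those whose ordering is supplied: forget
the supplier. So the typed fact is never stronger than what the paper proves.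
[cite: MarkovShi2008, §5 (Prop 5.1) and §1 (Thm 1.1)] -/
theorem markovShi2008_prop51_of_anyOrder
    (h : ∀ (c : ℕ) (F : QCircuitFamily cliffordT) (L : Language Bool),
      F.IsOracleFree → F.IsUniform → F.IsPolySize →
      (∀ n, ∃ σ : Fin (n + F.ancillas n) ≃ Fin (n + F.ancillas n),
        (F.circ n).cutParamUnder σ ≤ c * Nat.log 2 n + c) →
      (∀ x, (x ∈ L → 2 / 3 ≤ F.acceptProbOn 0 x) ∧ (x ∉ L → F.acceptProbOn 0 x ≤ 1 / 3)) →
      L ∈ P) :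
    markovShi2008_prop51 := by
  intro c F L hOF hU hPS hCut hDec
  obtain ⟨_, -, hs⟩ := hCut
  exact h c F L hOF hU hPS (fun n => (hs n).imp fun _ hσ => hσ.1) hDec

/-- The ordering-free Cor 1.5 implies the typed (identity-ordering) `markovShi2008_cor15`:
take `σ = 1`. [cite: MarkovShi2008, §1 (Cor 1.5)] -/
theorem markovShi2008_cor15_of_anyOrder (h : markovShi2008_cor15_anyOrder) :
    markovShi2008_cor15 :=
  fun q c F L hOF hU hPS hLoc hD hDec =>
    h q c F L hOF hU hPS (fun n => ⟨Equiv.refl _, hLoc n⟩) hD hDec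

/-- **Ordering-free Prop 5.1 implies ordering-free Cor 1.5**, the source's one-line derivation
made formal: under `q`-locality the cut parameter is `≤ q · depth ≤ (qc)·log₂ n + qc`
(`QCircuit.cutParamUnder_le`), whatever the ordering. The hypothesis is Prop 5.1 in the
ordering-free form (the conclusion of `markovShi2008_prop51_anyOrder_of_thm46`; up to the
restatement of 2026-08-15 it was the named fact `markovShi2008_prop51` itself and this theorem
was called `markovShi2008_cor15_anyOrder_of_prop51`). [cite: MarkovShi2008, §5 (after Prop 5.1)] -/
theorem markovShi2008_cor15_anyOrder_of_prop51_anyOrder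
    (h : ∀ (c : ℕ) (F : QCircuitFamily cliffordT) (L : Language Bool),
      F.IsOracleFree → F.IsUniform → F.IsPolySize →
      (∀ n, ∃ σ : Fin (n + F.ancillas n) ≃ Fin (n + F.ancillas n),
        (F.circ n).cutParamUnder σ ≤ c * Nat.log 2 n + c) →
      (∀ x, (x ∈ L → 2 / 3 ≤ F.acceptProbOn 0 x) ∧ (x ∉ L → F.acceptProbOn 0 x ≤ 1 / 3)) →
      L ∈ P) :
    markovShi2008_cor15_anyOrder := by
  intro q c F L hOF hU hPS hLoc hD hDec
  refine h (q * c) F L hOF hU hPS (fun n => ?_) hDec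
  obtain ⟨σ, hσ⟩ := hLoc n
  refine ⟨σ, (QCircuit.cutParamUnder_le hσ).trans ?_⟩
  calc q * (F.circ n).depth ≤ q * (c * Nat.log 2 n + c) := Nat.mul_le_mul_left _ (hD n)
    _ = q * c * Nat.log 2 n + q * c := by ring

/-- **Prop 5.1 implies Cor 1.5, both with the ordering supplied** (the typed forms of the same
one-line derivation "`r = O(qD)`"): a language decided with bounded error by a uniform
polynomial-size oracle-free Clifford+T family of depth `≤ c·log₂ n + c` which is
`q`-local-interacting under an ordering of its wires supplied by an `FP` function of `1ⁿ` is in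
`P`, given `markovShi2008_prop51` — the same supplier witnesses cut parameter
`≤ (qc)·log₂ n + qc` (`QCircuit.cutParamUnder_le`). [cite: MarkovShi2008, §1 (Cor 1.5) and §5 (after Prop 5.1)] -/
theorem markovShi2008_cor15_supplied_of_prop51 (h : markovShi2008_prop51) :
    ∀ (q c : ℕ) (F : QCircuitFamily cliffordT) (L : Language Bool),
      F.IsOracleFree → F.IsUniform → F.IsPolySize →
      (∃ s : List Bool → List Bool, s ∈ FP ∧ ∀ n,
        ∃ σ : Fin (n + F.ancillas n) ≃ Fin (n + F.ancillas n),
          (F.circ n).IsLocalInteractingUnder σ q ∧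
          s (unaryEncodeNat n) =
            encodingListNatBool.encode (List.ofFn fun w => ((σ w : Fin (n + F.ancillas n)) : ℕ))) →
      (∀ n, (F.circ n).depth ≤ c * Nat.log 2 n + c) →
      (∀ x, (x ∈ L → 2 / 3 ≤ F.acceptProbOn 0 x) ∧ (x ∉ L → F.acceptProbOn 0 x ≤ 1 / 3)) →
      L ∈ P := by
  intro q c F L hOF hU hPS hLoc hD hDec
  obtain ⟨s, hs, hσs⟩ := hLoc
  refine h (q * c) F L hOF hU hPS ⟨s, hs, fun n => ?_⟩ hDec
  obtain ⟨σ, hσ, hsn⟩ := hσs n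
  refine ⟨σ, (QCircuit.cutParamUnder_le hσ).trans ?_, hsn⟩
  calc q * (F.circ n).depth ≤ q * (c * Nat.log 2 n + c) := Nat.mul_le_mul_left _ (hD n)
    _ = q * c * Nat.log 2 n + q * c := by ring

end Literature.Barriers.QuantumAdvantage

end
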